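import Summits.BirchSwinnertonDyer.BirchSwinnertonDyer.Theorems.SchneiderFreeAdditiveX3GordCellThreeAux
import HarnessLib

/-!
# Route `SchneiderFreeAdditiveX3` (K1 door), the (G-ord, `e = 2`) cell AT `p = 3`: THE `(−3)`-TWIST PRESERVES THE RESIDUAL PAIR —
# a Teichmüller pair `(θsub, θquot)` of a rational `3`-line of `V` is, SWAPPED, a Teichmüller pair `(θquot, θsub)` of a rational `3`-line of
# `W = C • V^(−3)`; so every CHARACTER-level input typed «at the residual pair of the good partner» serves the additive twist BY NAME

Cell `bsd-schneider-ideate`, seat `bsd-schneider-door-c5` (prover, generation 28; assembly layer; `--supports` 19177).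
PARTITION: board row B6 ∩ X3 ∩ sst-twist, `r = 1`, (G-ord, `e = 2`) half at `p = 3` (2 411 pairs: 686 non-anomalous / 1 725 ANOMALOUS twists)
of `Rank1Residual.partition` — STRUCTURE THEOREM for the anomalous twin; types-the-object-of nothing; closes none of B6's cells (BSD NOT
advanced).  bears_on: K1-door (19177 r3 `GordTwoBranchIMC`).

## The observation (generation 26's «SWAP», now at the level of the residual pair)

At `p = 3` the twisting character `χ₋₃` IS the mod-`3` cyclotomic character `ω` (`σ√−3 = √−3 ↔ χ̄₃(σ) = 1`, the tree's
`MixedCongruence.smul_geomSqrt_neg_three_iff`).  If `Φ ≤ V[3]` is a rational line on which `Γ_ℚ` acts through `a(σ)` and on `V[3]/Φ` through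
`b(σ)`, the Weil pairing gives `a·b ≡ χ̄₃ (mod 3)` (§1, any `p`: `intCast_mul_eq_cyclotomic_of_stableLine`), hence — as `a² ≡ 1 (mod 3)` —
`χ̄₃·a ≡ b` and `χ̄₃·b ≡ a (mod 3)`.  Along the sign-equivariant twisting isomorphism `e : W[3] ≃ V[3]`, `e(σT) = χ₋₃(σ)·σe(T)`
(`exists_signEquiv_of_twist`, Silverman X.5.4), the transported line `Ψ = e⁻¹(Φ)` is therefore a rational line of `W` on which `Γ_ℚ` acts
through `χ₋₃·a ≡ b` and on `W[3]/Ψ` through `χ₋₃·b ≡ a`: **the Teichmüller pair of `Ψ ≤ W[3]` is `(θquot, θsub)`** — the pair of `V`, swapped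
(§2 `exists_isRationalLine_teichmullerPair_swap_of_negThree_twist`).  In words: `W[3]^ss ≅ V[3]^ss` as `Γ_ℚ`-modules (`{φ, ωφ⁻¹}·ω =
{ωφ, φ}` since `φ² = 1`), and which character sits on the line flips.

## Why it matters for the door (anomalous twin, 1 725 pairs at `p = 3`)

Every CHARACTER-level typed input of the Eisenstein literature is phrased «at the residual pair `(θsub, θquot)` of `E[p]` over `K`»
(`KellerYin2024.IsResidualPairOver (E.baseChange K) p θsub θquot`): CGLS 2022 Prop. 1.2.5 / Cor. 1.2.6 (published; `θ|_{D_v̄} ∉ {𝟙, ω}` — the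
non-anomalous case, used by generations 23–27), and for the ANOMALOUS case cell `bsd-eis`'s typed Keller–Yin 2402.12781 inputs for a GOOD anomalous
curve — [RH] `KellerYin2024.thm122_rubinHida_residualPair_unrSelmer` (Rubin 1991 + Hida 2010, `𝓕_nr` formulation), [PWL-θ]
`prop125_residualPair_unrSelmer_imprimitive`, `prop125_residualPair_unrSelmer_quotient/corank`, the Katz frames.  Their conclusions mention ONLY the
character modules `charModule ∅ θ`.  By §3 (`isResidualPairOver_swap_of_negThree_twist`: over every number field `K` the restricted pair of `V` and
the SWAPPED restricted pair of `W` are residual pairs of `V_K[3]`, `W_K[3]`), any such fact INSTANTIATED AT THE GOOD PARTNER `V = W^(−3)` (good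
ordinary at `3`; `Anom V 3` ⟺ the pair fails generation 25's NAT clause, §4) delivers its character-level conclusion for the residual pair of the
ADDITIVE curve `W` — no new Literature typing is needed for the anomalous twin's character inputs; what remains E-level is `W`'s own dévissage
(Keller–Yin Thm. 1.4.1-shape) and the analytic side.  §4 packages this on the cell: for `W` globally minimal with `ClassX3 W 3`, `SubGordTwo W 3`
there is a good-ordinary partner `V` (`exists_goodOrd_partner_of_subGordTwo_odd`) such that EVERY Teichmüller pair of `W` is, swapped, a
Teichmüller pair of `V` (and conversely), over `ℚ` and over every `K`; on the anomalous sub-cell `V` is `Good ∧ Red ∧ Anom` at `3` — the curve-side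
binders of the `bsd-eis` facts.

## What is here (theorems only; no definition, no named fact, no `sorry`)
* §1 `intCast_mul_eq_cyclotomic_of_stableLine` — `E/ℚ`, any prime `p`, `σ ∈ Γ_ℚ`, a line `L ≤ E[p]` with `σ = a` on `L` and `σ ≡ b` on `E[p]/L`:
  `a·b = χ̄_p(σ)` in `𝔽_p` (the determinant in a frame, `exists_frame_galoisRepTorsion_rat`; generalises cell `b2b-bsdres`'s
  `smul_eq_cyclotomic_zsmul_of_forall_sub_mem`, the case `b = 1`).  `three_dvd_sub_of_mul_eq_one` / `three_dvd_add_of_mul_eq_two`: the `𝔽₃`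
  arithmetic `ab = 1 ⇒ a = b`, `ab = −1 ⇒ a = −b`.
* §2 `exists_isRationalLine_teichmullerPair_swap_of_negThree_twist` — the swap over `ℚ` (any coefficient set `S`).
* §3 `isResidualPairOver_swap_of_negThree_twist` — over every number field `K` (restricted pairs, `S = ∅`), both curves at once.
* §4 `exists_partner_teichmullerPair_swap_of_subGordTwo_three` — on the cell, with the partner's `Good`/`Red` and the `Anom ↔ ¬NAT` reading.

HONEST FRAMING: finite group theory / Galois bookkeeping over tree theorems (Serre's determinant, Silverman X.5.4, the tree's Teichmüller-lift
predicates); CONDITIONAL on nothing; nothing analytic; nothing is closed; BSD is proved for no curve; «closes rung: none».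
References: [Serre1972] §1.11 (det ρ̄_{E,p} = χ̄_p); [SilvermanAEC2009] X.5 Cor. 5.4 (quadratic twist); [KellerYin2024] §1.4 (the characters
`φ`, `ψ` of `ρ̄_f`, arXiv:2402.12781v2), Thm. 1.2.2 / Prop. 1.2.5 (the character-level inputs); [CastellaGrossiLeeSkinner2022] §1.2, §2.2 (labelling
of the pair); this seat p679286 (generation 26, the SWAP on the analytic side), p684153 (generation 27), cell `b2b-bsdres` TB-TOL files.
-/

set_option autoImplicit false
-- `Summit.<P>.<Sub>` repeats `BirchSwinnertonDyer` by the tree's layout convention (D-0017)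
set_option linter.dupNamespace false

noncomputable section

open scoped Classical NumberField Pointwise Matrix

open Field NumberField IsDedekindDomain WeierstrassCurve Rat.HeightOneSpectrum
  Literature.NumberTheory.EllipticCurves Literature.NumberTheory.EllipticCurves.GreenbergSelmer
  Literature.NumberTheory.GaloisRepresentations
  Literature.NumberTheory.EllipticCurves.Rank1Residual
  Literature.NumberTheory.EllipticCurves.KellerYin2024
  Summit.BirchSwinnertonDyer.Rank1Residual Summit.BirchSwinnertonDyer.Rank1Residual.GaloisImage
  Summit.BirchSwinnertonDyer.Rank1Residual.Additive
  Summit.BirchSwinnertonDyer.BirchSwinnertonDyer.Theorems.SchneiderFree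
  Summit.BirchSwinnertonDyer.BirchSwinnertonDyer.Theorems.EisensteinPrimesMuLambda

namespace Summit.BirchSwinnertonDyer.BirchSwinnertonDyer.Theorems.SchneiderFreeAdditiveX3.TwistThreeResidualPair

/-! ### §1 The determinant reads a stable line and its quotient: `a·b = χ̄_p(σ)`; `𝔽₃` arithmetic -/

section Det

variable {W : WeierstrassCurve ℚ} [W.IsElliptic] {p : ℕ} [hp : Fact p.Prime]

/-- **`a·b = χ̄_p(σ)`.**  Let `L ≤ E[p]` be a line, `σ ∈ Γ_ℚ` acting on `L` by the integer `a` (`σP = aP`) and on `E[p]/L` by the integer `b`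
(`σQ − bQ ∈ L`).  Then `a·b ≡ χ̄_p(σ) (mod p)`: in a frame `E[p] ≅ 𝔽_p²` (`exists_frame_galoisRepTorsion_rat`, with `det = χ̄_p` by the Weil
pairing) the matrix `M` of `σ` satisfies `Mu = au`, `Mw = bw + tu` for `u = e(x₀)`, `x₀ ∈ L ∖ 0`, `w = e(q₀)`, `q₀ ∉ L`, whence
`det M · (u₀w₁ − u₁w₀) = ab · (u₀w₁ − u₁w₀)` with `u₀w₁ − u₁w₀ ≠ 0`.  (Cell `b2b-bsdres`'s `smul_eq_cyclotomic_zsmul_of_forall_sub_mem` is the case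
`b = 1`.) [cite: Serre1972, §1.11 (det ρ̄ = χ̄_p)] -/
theorem intCast_mul_eq_cyclotomic_of_stableLine (σ : absoluteGaloisGroup ℚ)
    {L : AddSubgroup (geomTorsion W (p : ℤ))} (hL : Nat.card L = p) {a b : ℤ}
    (ha : ∀ P ∈ L, σ • P = a • P) (hb : ∀ Q : geomTorsion W (p : ℤ), σ • Q - b • Q ∈ L) :
    ((a * b : ℤ) : ZMod p) = ((modPCyclotomicCharacterZMod ℚ p σ : (ZMod p)ˣ) : ZMod p) := by
  have hpp : p.Prime := hp.out
  -- a frame, a generator `x₀` of `L` and a point `q₀` outside `L`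
  obtain ⟨e, Φ, he, -, hdetχ, -, -⟩ := exists_frame_galoisRepTorsion_rat W p
  have hLbot : L ≠ ⊥ := by
    intro h
    have h1 : Nat.card L = 1 := by rw [h]; exact AddSubgroup.card_bot
    exact hpp.one_lt.ne' (hL.symm.trans h1)
  obtain ⟨⟨x₀, hx₀L⟩, hx₀⟩ := (AddSubgroup.ne_bot_iff_exists_ne_zero).mp hLbot
  have hx₀' : (x₀ : geomTorsion W (p : ℤ)) ≠ 0 := fun h ↦ hx₀ (Subtype.ext h)
  obtain ⟨q₀, hq₀⟩ := exists_not_mem_of_natCard_eq hL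
  have hLeq := MixedCongruence.zmultiples_eq_of_mem_of_ne_zero hL hx₀L hx₀'
  obtain ⟨t, ht⟩ : ∃ t : ℤ, t • x₀ = σ • q₀ - b • q₀ :=
    AddSubgroup.mem_zmultiples_iff.mp (hLeq.symm ▸ hb q₀)
  -- the matrix `M` of `σ` and the vectors `u = e x₀`, `w = e q₀`
  set M : Matrix (Fin 2) (Fin 2) (ZMod p) :=
    ((Φ (galoisRepTorsion W p σ) : GL (Fin 2) (ZMod p)) : Matrix (Fin 2) (Fin 2) (ZMod p)) with hM
  set u : Fin 2 → ZMod p := e x₀ with hu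
  set w : Fin 2 → ZMod p := e q₀ with hw
  have heσ : ∀ Q : geomTorsion W (p : ℤ), e (σ • Q) = M *ᵥ e Q := fun Q ↦ by
    rw [hM, ← he, galoisRepTorsion_apply]
  have hMu : M *ᵥ u = (a : ZMod p) • u := by
    rw [hu, ← heσ, ha x₀ hx₀L, map_zsmul, Int.cast_smul_eq_zsmul]
  have hMw : M *ᵥ w = (b : ZMod p) • w + (t : ZMod p) • u := by
    rw [hw, hu, ← heσ, show σ • q₀ = b • q₀ + t • x₀ by rw [ht, add_sub_cancel], map_add, map_zsmul, map_zsmul,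
      Int.cast_smul_eq_zsmul, Int.cast_smul_eq_zsmul]
  -- componentwise
  have hrow : ∀ (v : Fin 2 → ZMod p) (i : Fin 2), (M *ᵥ v) i = M i 0 * v 0 + M i 1 * v 1 :=
    fun v i ↦ by simp [Matrix.mulVec, dotProduct, Fin.sum_univ_two]
  have E1 : M 0 0 * u 0 + M 0 1 * u 1 = a * u 0 := by
    have h := congrFun hMu 0; rwa [hrow, Pi.smul_apply, smul_eq_mul] at h
  have E2 : M 1 0 * u 0 + M 1 1 * u 1 = a * u 1 := by
    have h := congrFun hMu 1; rwa [hrow, Pi.smul_apply, smul_eq_mul] at h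
  have E3 : M 0 0 * w 0 + M 0 1 * w 1 = b * w 0 + t * u 0 := by
    have h := congrFun hMw 0; rwa [hrow, Pi.add_apply, Pi.smul_apply, Pi.smul_apply, smul_eq_mul, smul_eq_mul] at h
  have E4 : M 1 0 * w 0 + M 1 1 * w 1 = b * w 1 + t * u 1 := by
    have h := congrFun hMw 1; rwa [hrow, Pi.add_apply, Pi.smul_apply, Pi.smul_apply, smul_eq_mul, smul_eq_mul] at h
  -- `det M · D = ab · D` with `D = u₀ w₁ − u₁ w₀`
  have hdet : M.det * (u 0 * w 1 - u 1 * w 0) = ((a : ZMod p) * b) * (u 0 * w 1 - u 1 * w 0) := by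
    rw [Matrix.det_fin_two]
    linear_combination (M 1 0 * w 0 + M 1 1 * w 1) * E1 - (M 0 0 * w 0 + M 0 1 * w 1) * E2 +
      ((a : ZMod p) * u 0) * E4 - ((a : ZMod p) * u 1) * E3
  -- `D ≠ 0`: otherwise `w ∈ 𝔽_p u`, i.e. `q₀ ∈ L`
  have hu0 : u ≠ 0 := by
    intro h
    apply hx₀'
    apply e.injective
    rw [← hu, h, map_zero]
  have hD : u 0 * w 1 - u 1 * w 0 ≠ 0 := by
    intro hD
    obtain ⟨c, hc⟩ : ∃ c : ZMod p, w = c • u := by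
      by_cases h0 : u 0 = 0
      · have h1 : u 1 ≠ 0 := by
          intro h1
          apply hu0
          ext i
          fin_cases i
          · exact h0
          · exact h1
        have hw0 : w 0 = 0 := by
          have : u 1 * w 0 = 0 := by rw [h0, zero_mul, zero_sub, neg_eq_zero] at hD; exact hD
          exact (mul_eq_zero.mp this).resolve_left h1
        refine ⟨w 1 / u 1, ?_⟩
        ext i
        fin_cases i
        · simp [h0, hw0]
        · simp [div_mul_cancel₀ _ h1]
      · refine ⟨w 0 / u 0, ?_⟩
        ext i
        fin_cases i
        · simp [div_mul_cancel₀ _ h0]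
        · simp only [Fin.isValue, Fin.mk_one, Pi.smul_apply, smul_eq_mul]
          rw [sub_eq_zero] at hD
          field_simp
          linear_combination hD
    apply hq₀
    have hq : q₀ = (c.val : ℤ) • x₀ := by
      apply e.injective
      rw [map_zsmul, ← hu, ← hw, hc, ← Int.cast_smul_eq_zsmul (ZMod p), Int.cast_natCast,
        ZMod.natCast_zmod_val]
    rw [hq]
    exact L.zsmul_mem hx₀L _
  have hdetM : M.det = (a : ZMod p) * b := mul_right_cancel₀ hD hdet
  -- `det M = χ̄_p(σ)` (Weil pairing)
  have hχ : M.det = ((modPCyclotomicCharacterZMod ℚ p σ : (ZMod p)ˣ) : ZMod p) := by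
    rw [hM, ← Matrix.GeneralLinearGroup.val_det_apply, hdetχ σ]
  rw [Int.cast_mul, ← hdetM, hχ]

/-- `𝔽₃` arithmetic: `ab = 1 ⇒ 3 ∣ a − b` (`a, b ∈ {±1}`, `b = a⁻¹ = a`). [folklore] -/
theorem three_dvd_sub_of_mul_eq_one {a b : ℤ} (h : ((a * b : ℤ) : ZMod 3) = 1) : (3 : ℤ) ∣ a - b := by
  have key : ∀ x y : ZMod 3, x * y = 1 → x - y = 0 := by decide
  have h' : ((a - b : ℤ) : ZMod 3) = 0 := by
    rw [Int.cast_sub]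
    rw [Int.cast_mul] at h
    exact key _ _ h
  exact (ZMod.intCast_zmod_eq_zero_iff_dvd (a - b) 3).mp h'

/-- `𝔽₃` arithmetic: `ab = 2 = −1 ⇒ 3 ∣ a + b` (`b = −a⁻¹ = −a`). [folklore] -/
theorem three_dvd_add_of_mul_eq_two {a b : ℤ} (h : ((a * b : ℤ) : ZMod 3) = 2) : (3 : ℤ) ∣ a + b := by
  have key : ∀ x y : ZMod 3, x * y = 2 → x + y = 0 := by decide
  have h' : ((a + b : ℤ) : ZMod 3) = 0 := by
    rw [Int.cast_add]
    rw [Int.cast_mul] at h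
    exact key _ _ h
  exact (ZMod.intCast_zmod_eq_zero_iff_dvd (a + b) 3).mp h'

omit [W.IsElliptic] in
/-- On `E[3]`, integers congruent mod `3` act alike. [folklore] -/
theorem zsmul_eq_zsmul_of_three_dvd_sub {m n : ℤ} (h : (3 : ℤ) ∣ m - n) (P : geomTorsion W ((3 : ℕ) : ℤ)) :
    m • P = n • P := by
  obtain ⟨k, hk⟩ := h
  have hm : m = n + k * 3 := by rw [mul_comm]; omega
  have h3 : (3 : ℤ) • P = 0 := by exact_mod_cast natCast_zsmul_eq_zero P
  rw [hm, add_zsmul, mul_zsmul, h3, zsmul_zero, add_zero]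

end Det

/-! ### §2 The swap over `ℚ`: a Teichmüller pair `(θsub, θquot)` of `V` gives the pair `(θquot, θsub)` of `W = C • V^(−3)` -/

section Swap

variable {V W : WeierstrassCurve ℚ}

/-- **THE `(−3)`-TWIST SWAPS THE TEICHMÜLLER PAIR.**  Let `W = C • V^(−3)`, `Φ ≤ V[3]` a rational line and `θsub`, `θquot : Γ_ℚ → GL₁(𝓞)`
Teichmüller lifts of the characters of `Γ_ℚ` on `Φ` and on `V[3]/Φ` (`KellerYin2024.IsTeichmullerLiftOn(Quot)`).  Then the line `Ψ = e⁻¹(Φ) ≤ W[3]`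
transported along the twisting isomorphism (`e(σT) = χ₋₃(σ)·σe(T)`) is a rational line of `W`, `θquot` is the Teichmüller lift of the character
of `Γ_ℚ` on `Ψ` and `θsub` that of the character on `W[3]/Ψ` — with the SAME integer witnesses: for `σ` with witnesses `a` (on `Φ`) and `b` (on
`V[3]/Φ`), `ab ≡ χ̄₃(σ)` (§1) and `χ₋₃(σ) = χ̄₃(σ)` give `σ = χ̄₃a ≡ b` on `Ψ` and `σ ≡ χ̄₃b ≡ a` on `W[3]/Ψ`.
[cite: SilvermanAEC2009, X.5 Cor. 5.4] [cite: Serre1972, §1.11] [cite: KellerYin2024, §1.4 (arXiv:2402.12781v2 TeX L1063–1086: the characters φ, ψ)] -/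
theorem exists_isRationalLine_teichmullerPair_swap_of_negThree_twist [V.IsElliptic] (C : VariableChange ℚ)
    (hC : C • V.quadraticTwist (-3 : ℚ) = W) {S : Set (PadicAlgCl 3)}
    {Φ : AddSubgroup (geomTorsion V ((3 : ℕ) : ℤ))} (hΦ : IsRationalLine V 3 Φ)
    {θsub θquot : FramedGaloisRep ℚ (padicCoeffIntegers S) 1}
    (hsub : IsTeichmullerLiftOn S (Φ.map (geomTorsion V ((3 : ℕ) : ℤ)).subtype) θsub)
    (hquot : IsTeichmullerLiftOnQuot S (Φ.map (geomTorsion V ((3 : ℕ) : ℤ)).subtype) (geomTorsion V ((3 : ℕ) : ℤ)) θquot) :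
    ∃ Ψ : AddSubgroup (geomTorsion W ((3 : ℕ) : ℤ)), IsRationalLine W 3 Ψ ∧
      IsTeichmullerLiftOn S (Ψ.map (geomTorsion W ((3 : ℕ) : ℤ)).subtype) θquot ∧
      IsTeichmullerLiftOnQuot S (Ψ.map (geomTorsion W ((3 : ℕ) : ℤ)).subtype) (geomTorsion W ((3 : ℕ) : ℤ)) θsub := by
  have hd0 : (-3 : ℚ) ≠ 0 := by norm_num
  have hC' : C⁻¹ • W = V.quadraticTwist (-3 : ℚ) := by rw [← hC, inv_smul_smul]
  obtain ⟨e, hpos, hneg⟩ := exists_signEquiv_of_twist (W := V) (Wd := W) (p := 3) hd0 C⁻¹ hC'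
  obtain ⟨hcard, hstab⟩ := hΦ
  -- the transported line `Ψ = e⁻¹(Φ)`
  set Ψ : AddSubgroup (geomTorsion W ((3 : ℕ) : ℤ)) := Φ.map e.symm.toAddMonoidHom with hΨdef
  have hmemΨ : ∀ T, T ∈ Ψ ↔ e T ∈ Φ := fun T ↦ by
    rw [hΨdef, AddSubgroup.mem_map_equiv, AddEquiv.symm_symm]
  have hΨcard : Nat.card Ψ = 3 :=
    (Nat.card_congr (Φ.equivMapOfInjective e.symm.toAddMonoidHom e.symm.injective).toEquiv).symm.trans hcard
  have hΨstab : ∀ σ : absoluteGaloisGroup ℚ, ∀ T ∈ Ψ, σ • T ∈ Ψ := fun σ T hT ↦ by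
    rw [hmemΨ] at hT ⊢
    by_cases hs : σ • geomSqrt (-3 : ℚ) = geomSqrt (-3 : ℚ)
    · rw [hpos σ hs T]; exact hstab σ _ hT
    · rw [hneg σ hs T]; exact Φ.neg_mem (hstab σ _ hT)
  -- the scalar readings of `hsub`, `hquot` on the torsion type
  have hsub' : ∀ σ : absoluteGaloisGroup ℚ, ∃ a : ℤ,
      ‖((entry S θsub σ : padicCoeffIntegers S) : PadicAlgCl 3) - (a : PadicAlgCl 3)‖ < 1 ∧
        ∀ P ∈ Φ, σ • P = a • P := fun σ ↦ by
    obtain ⟨a, ha, hmem⟩ := hsub.exists_smul_eq σ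
    refine ⟨a, ha, fun P hP ↦ Subtype.ext ?_⟩
    have h := hmem ((P : geomTorsion V ((3 : ℕ) : ℤ)) : geomPoints V) ⟨P, hP, rfl⟩
    rw [AddSubgroup.torsionBy.coe_smul, AddSubgroupClass.coe_zsmul]
    exact h
  have hquot' : ∀ σ : absoluteGaloisGroup ℚ, ∃ b : ℤ,
      ‖((entry S θquot σ : padicCoeffIntegers S) : PadicAlgCl 3) - (b : PadicAlgCl 3)‖ < 1 ∧
        ∀ Q : geomTorsion V ((3 : ℕ) : ℤ), σ • Q - b • Q ∈ Φ := fun σ ↦ by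
    obtain ⟨b, hb, hmem⟩ := hquot.2 σ
    refine ⟨b, hb, fun Q ↦ ?_⟩
    obtain ⟨R, hR, hRQ⟩ := hmem (Q : geomPoints V) Q.2
    have hRQ' : R = σ • Q - b • Q := Subtype.ext (by
      rw [AddSubgroup.coe_subtype] at hRQ
      rw [hRQ, AddSubgroupClass.coe_sub, AddSubgroup.torsionBy.coe_smul, AddSubgroupClass.coe_zsmul])
    exact hRQ' ▸ hR
  -- the sign of `σ` on `√−3` IS `χ̄₃(σ)`, and `ab ≡ χ̄₃(σ)`: the two congruences
  have hcong : ∀ (σ : absoluteGaloisGroup ℚ) {a b : ℤ}, (∀ P ∈ Φ, σ • P = a • P) →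
      (∀ Q : geomTorsion V ((3 : ℕ) : ℤ), σ • Q - b • Q ∈ Φ) →
      (σ • geomSqrt (-3 : ℚ) = geomSqrt (-3 : ℚ) → (3 : ℤ) ∣ a - b) ∧
        (¬ σ • geomSqrt (-3 : ℚ) = geomSqrt (-3 : ℚ) → (3 : ℤ) ∣ a + b) := by
    intro σ a b haΦ hbΦ
    have hab := intCast_mul_eq_cyclotomic_of_stableLine σ hcard haΦ hbΦ
    refine ⟨fun hs ↦ ?_, fun hs ↦ ?_⟩
    · have h1 : modPCyclotomicCharacterZMod ℚ 3 σ = 1 := (MixedCongruence.smul_geomSqrt_neg_three_iff σ).mp hs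
      rw [h1, Units.val_one] at hab
      exact three_dvd_sub_of_mul_eq_one hab
    · have h1 : modPCyclotomicCharacterZMod ℚ 3 σ ≠ 1 := fun h ↦ hs ((MixedCongruence.smul_geomSqrt_neg_three_iff σ).mpr h)
      have h2 : ((modPCyclotomicCharacterZMod ℚ 3 σ : (ZMod 3)ˣ) : ZMod 3) = 2 := by
        rw [← ZMod.natCast_zmod_val ((modPCyclotomicCharacterZMod ℚ 3 σ : (ZMod 3)ˣ) : ZMod 3),
          MixedCongruence.val_modPCyclotomicCharacterZMod_three_eq_two h1]
        rfl
      rw [h2] at hab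
      exact three_dvd_add_of_mul_eq_two hab
  refine ⟨Ψ, ⟨hΨcard, hΨstab⟩, ⟨hquot.1, fun σ ↦ ?_⟩, ⟨hsub.1, fun σ ↦ ?_⟩⟩
  · -- `Γ_ℚ` acts on `Ψ` through `θquot`
    obtain ⟨a, -, haΦ⟩ := hsub' σ
    obtain ⟨b, hb, hbΦ⟩ := hquot' σ
    obtain ⟨hfix, hmove⟩ := hcong σ haΦ hbΦ
    refine ⟨b, hb, ?_⟩
    rintro _ ⟨T, hT, rfl⟩
    have hT' : e T ∈ Φ := (hmemΨ T).mp hT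
    have key : σ • T = b • T := by
      apply e.injective
      by_cases hs : σ • geomSqrt (-3 : ℚ) = geomSqrt (-3 : ℚ)
      · rw [hpos σ hs T, haΦ _ hT', map_zsmul]
        exact zsmul_eq_zsmul_of_three_dvd_sub (hfix hs) (e T)
      · rw [hneg σ hs T, haΦ _ hT', map_zsmul, ← neg_zsmul]
        exact zsmul_eq_zsmul_of_three_dvd_sub (by obtain ⟨k, hk⟩ := hmove hs; exact ⟨-k, by linarith⟩) (e T)
    rw [AddSubgroup.mem_bot, AddSubgroup.coe_subtype, ← AddSubgroup.torsionBy.coe_smul, key, AddSubgroupClass.coe_zsmul, sub_self]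
  · -- `Γ_ℚ` acts on `W[3]/Ψ` through `θsub`
    obtain ⟨a, ha, haΦ⟩ := hsub' σ
    obtain ⟨b, -, hbΦ⟩ := hquot' σ
    obtain ⟨hfix, hmove⟩ := hcong σ haΦ hbΦ
    refine ⟨a, ha, fun P hP ↦ ?_⟩
    set T : geomTorsion W ((3 : ℕ) : ℤ) := ⟨P, hP⟩ with hTdef
    refine ⟨σ • T - a • T, (hmemΨ _).mpr ?_, ?_⟩
    · rw [map_sub, map_zsmul]
      by_cases hs : σ • geomSqrt (-3 : ℚ) = geomSqrt (-3 : ℚ)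
      · rw [hpos σ hs T, zsmul_eq_zsmul_of_three_dvd_sub (hfix hs) (e T)]
        exact hbΦ (e T)
      · rw [hneg σ hs T]
        have h3 : (a + b) • e T = 0 := by
          rw [zsmul_eq_zsmul_of_three_dvd_sub (m := a + b) (n := 0) (by simpa using hmove hs) (e T), zero_zsmul]
        have hrw : -(σ • e T) - a • e T = -(σ • e T - b • e T) - (a + b) • e T := by
          rw [add_zsmul]; abel
        rw [hrw, h3, sub_zero]
        exact Φ.neg_mem (hbΦ (e T))
    · rw [AddSubgroup.coe_subtype, AddSubgroupClass.coe_sub, AddSubgroup.torsionBy.coe_smul, AddSubgroupClass.coe_zsmul]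

end Swap

/-! ### §3 Over a number field `K`: the restricted pair of `V` and the SWAPPED restricted pair of `W` are residual pairs -/

section OverK

variable {V W : WeierstrassCurve ℚ}

/-- **Residual pairs over `K`, both curves at once.**  For `W = C • V^(−3)`, a rational `3`-line `Φ ≤ V[3]` with Teichmüller pair
`(θsub, θquot)` over `ℚ` (coefficients `ℤ₃ = 𝓞_{ℚ₃(∅)}`) and ANY number field `K`: `(θsub|_K, θquot|_K)` is a residual pair of `V_K[3]` and
`(θquot|_K, θsub|_K)` a residual pair of `W_K[3]` (`KellerYin2024.IsResidualPairOver`).  So a character-level fact typed «at the residual pair of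
`V` over `K`» and one typed «at the residual pair of `W` over `K`» speak about the SAME two characters.  §2 ∘ `isResidualPairOver_restrictField`.
[cite: KellerYin2024, §1.4 (arXiv:2402.12781v2 TeX L1063–1086)] [cite: SilvermanAEC2009, X.5 Cor. 5.4] -/
theorem isResidualPairOver_swap_of_negThree_twist [V.IsElliptic] [W.IsElliptic] (C : VariableChange ℚ)
    (hC : C • V.quadraticTwist (-3 : ℚ) = W)
    (K : Type) [Field K] [NumberField K]
    {Φ : AddSubgroup (geomTorsion V ((3 : ℕ) : ℤ))} (hΦ : IsRationalLine V 3 Φ)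
    {θsub θquot : FramedGaloisRep ℚ (padicCoeffIntegers (∅ : Set (PadicAlgCl 3))) 1}
    (hsub : IsTeichmullerLiftOn (∅ : Set (PadicAlgCl 3)) (Φ.map (geomTorsion V ((3 : ℕ) : ℤ)).subtype) θsub)
    (hquot : IsTeichmullerLiftOnQuot (∅ : Set (PadicAlgCl 3)) (Φ.map (geomTorsion V ((3 : ℕ) : ℤ)).subtype)
      (geomTorsion V ((3 : ℕ) : ℤ)) θquot) :
    IsResidualPairOver (V.baseChange K) 3 (θsub.restrictField K) (θquot.restrictField K) ∧
      IsResidualPairOver (W.baseChange K) 3 (θquot.restrictField K) (θsub.restrictField K) := by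
  obtain ⟨Ψ, hΨ, h1, h2⟩ := exists_isRationalLine_teichmullerPair_swap_of_negThree_twist C hC hΦ hsub hquot
  exact ⟨isResidualPairOver_restrictField V 3 K hΦ hsub hquot, isResidualPairOver_restrictField W 3 K hΨ h1 h2⟩

end OverK

/-! ### §4 On the (G-ord, `e = 2`) cell at `p = 3`: the partner carries every Teichmüller pair of `W`, swapped; `Anom ↔ ¬NAT` -/

section Cell

/-- **The partner carries every Teichmüller pair of `W`, swapped.**  For `W/ℚ` globally minimal on the (G-ord, `e = 2`) cell at `p = 3`
(`ClassX3 W 3`, `SubGordTwo W 3`) there are a globally minimal `V`, GOOD ORDINARY at `3`, and `C` with `C • V^(−3) = W`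
(`exists_goodOrd_partner_of_subGordTwo_odd`) such that: `V[3]` is reducible, and for EVERY rational `3`-line `Φ ≤ W[3]` with Teichmüller pair
`(θsub, θquot)` (any coefficient set `S`) there is a rational `3`-line of `V` with Teichmüller pair `(θquot, θsub)`.  (The twist is undone by
`exists_smul_quadraticTwist_eq_of_smul_quadraticTwist_eq` and §2 applied to `V = C″ • W^(−3)`.)  Moreover `V` is ANOMALOUS at `3` (`Anom V 3`:
`3 ∣ a₃(V) − 1`) unless the pair satisfies generation 25's non-anomalous-twist clause for this partner — i.e. on the anomalous sub-cell the
partner meets the curve-side binders `2 < 3`, `Good V 3`, `Red V 3`, `Anom V 3` of cell `bsd-eis`'s typed Keller–Yin 2402.12781 character facts.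
[cite: SilvermanAEC2009, X.5 Cor. 5.4, VII.5.1] [cite: KellerYin2024, §1.4, Thm. 1.2.2, Prop. 1.2.5 (arXiv:2402.12781v2)]
[cite: Delbourgo1998, §1.5 (hypothesis (G), p. 130)] -/
theorem exists_partner_teichmullerPair_swap_of_subGordTwo_three (W : WeierstrassCurve ℚ) [W.IsElliptic] [W.IsGloballyMinimal]
    (hX : ClassX3 W 3) (hS : SubGordTwo W 3) :
    ∃ (V : WeierstrassCurve ℚ) (_ : V.IsElliptic) (_ : V.IsGloballyMinimal) (C : VariableChange ℚ),
      C • V.quadraticTwist (-3 : ℚ) = W ∧ GoodOrd V 3 ∧ Red V 3 ∧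
      (∀ (S : Set (PadicAlgCl 3)) (Φ : AddSubgroup (geomTorsion W ((3 : ℕ) : ℤ))), IsRationalLine W 3 Φ →
        ∀ (θsub θquot : FramedGaloisRep ℚ (padicCoeffIntegers S) 1),
          IsTeichmullerLiftOn S (Φ.map (geomTorsion W ((3 : ℕ) : ℤ)).subtype) θsub →
          IsTeichmullerLiftOnQuot S (Φ.map (geomTorsion W ((3 : ℕ) : ℤ)).subtype) (geomTorsion W ((3 : ℕ) : ℤ)) θquot →
          ∃ Φ' : AddSubgroup (geomTorsion V ((3 : ℕ) : ℤ)), IsRationalLine V 3 Φ' ∧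
            IsTeichmullerLiftOn S (Φ'.map (geomTorsion V ((3 : ℕ) : ℤ)).subtype) θquot ∧
            IsTeichmullerLiftOnQuot S (Φ'.map (geomTorsion V ((3 : ℕ) : ℤ)).subtype) (geomTorsion V ((3 : ℕ) : ℤ)) θsub) ∧
      ((3 : ℤ) ∣ V.frobeniusTrace 3 - 1 → Anom V 3) := by
  have hp2 : (3 : ℕ) ≠ 2 := by norm_num
  obtain ⟨V, hEV, hminV, C, hC, hordV, -⟩ := exists_goodOrd_partner_of_subGordTwo_odd hp2 W hX hS
  have h3 : ((-1 : ℚ) ^ ((3 : ℕ) / 2) * ((3 : ℕ) : ℚ)) = (-3 : ℚ) := by norm_num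
  rw [h3] at hC
  have hd0 : (-3 : ℚ) ≠ 0 := by norm_num
  -- undo the twist: `V = C″ • W^(−3)`
  obtain ⟨C'', hC''⟩ := exists_smul_quadraticTwist_eq_of_smul_quadraticTwist_eq V W hd0 C hC
  -- `V[3]` is reducible: a rational line of `W` transports to one of `V`
  obtain ⟨Φ₀, hΦ₀, θ₁, θ₂, h₁, h₂⟩ := exists_teichmullerPair W 3 hX.1
  obtain ⟨Φ₀', hΦ₀', -, -⟩ := exists_isRationalLine_teichmullerPair_swap_of_negThree_twist C'' hC'' hΦ₀ h₁ h₂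
  have hredV : Red V 3 := not_hasIrreducibleModPGaloisRep_of_isRationalLine hΦ₀'
  refine ⟨V, hEV, hminV, C, hC, hordV, hredV, fun S Φ hΦ θsub θquot hsub hquot ↦
    exists_isRationalLine_teichmullerPair_swap_of_negThree_twist C'' hC'' hΦ hsub hquot, fun hdvd ↦ ?_⟩
  exact ⟨hredV, hordV.1, hdvd⟩

end Cell

end Summit.BirchSwinnertonDyer.BirchSwinnertonDyer.Theorems.SchneiderFreeAdditiveX3.TwistThreeResidualPair

end
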